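import Summits.BirchSwinnertonDyer.BirchSwinnertonDyer.Theorems.ByReductionTypeAtTwoEulerCharCoinvExact
import Summits.BirchSwinnertonDyer.BirchSwinnertonDyer.Theorems.ByReductionTypeAtTwoEulerCharCoinvInput
import Summits.BirchSwinnertonDyer.BirchSwinnertonDyer.Theorems.ByReductionTypeAtTwoEulerCharDevissage
import Summits.BirchSwinnertonDyer.BirchSwinnertonDyer.Theorems.ByReductionTypeAtTwoEulerCharReductionCount
import Literature.NumberTheory.EllipticCurves.Greenberg1999.LocalH1DivisibleCyclotomicProofs
import Literature.NumberTheory.EllipticCurves.BSDRootNumberSmallConductorProofs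
import HarnessLib

/-!
# Route `ByReductionTypeAtTwo` (K4), TOWER road — Greenberg's Lemma 3.4 at layer `0` reduced to the FORMAL-GROUP coinvariant
# count: `#𝒦_{v,0}[p^∞] = (p^{ord_p #Ẽ(𝔽_p)})²` as soon as `#(Ê(𝔪_∞)/(g−1))[p^∞] = p^{ord_p #Ẽ(𝔽_p)}`

Cell `bsd-2adic`, seat `bsd-2adic-tower-1` (GEN 25), `--supports stmt-BirchSwinnertonDyer-19271` (helper). TOOL theorem only
(no definition, no named fact, no `sorry`); closes nothing by itself; BSD is not proved by any of this. Part (e₁) of the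
programme «Greenberg LNM 1716 Lemma 3.4 at layer `0` EXACT ⇒ Thm. 4.1 over `ℚ` ⇒ the `hEC` binder of the TOWER doors in the
kernel» — the assembly of parts (a) `…EulerCharCoinvExact`, (b) `…EulerCharCoinvInput` / `…EulerCharDevissage`,
(d) `…EulerCharReductionCount` at the PACKAGE level of this lineage's GEN 11/20 bricks (`red₀`, an inertial topological generator
`g` of `Γ_{ℚ_v}` modulo `H_∞`, `M₁ = E(K̄_v)^{H_∞} ∩ ker red₀`, `D₁ = g − 1`):

  `#𝒦_{v,0}[p^∞] = #(M/(g−1)M)[p^∞]` (a) `= #(M₁/(g−1)M₁)[p^∞] · #red₀(M)[p^∞]` (b) `= #(M₁/(g−1)M₁)[p^∞] · p^{ord_p #Ẽ(𝔽_p)}` (d).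

* **`natCard_localTowerKerPrimary_zero_eq_sq_of_formalCount`** — for `W/ℚ` globally minimal and elliptic with `GoodOrd W p`,
  `κ` the cyclotomic `ℤ_p`-extension, `v ∋ p`, the spectral valuation `w` with the reduction `red₀` of the good model
  `W_ℤ ⊗ 𝒪_w`, an INERTIAL `g` generating `Γ_{ℚ_v}` topologically with `H_∞`, and `M₁`, `D₁` as above: IF the `p`-power
  torsion of the formal-group coinvariants `M₁/(g−1)M₁` is finite of order `p^{ord_p #Ẽ(𝔽_p)}` (Greenberg p. 89: the factor
  `#Ẽ(𝔽_p)_p` coming from `H¹(ℚ_p, Ê) `— Coates–Greenberg + Tate duality; this lineage's GEN 20 brick F proves `≤ #SF`), THEN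
  **`#𝒦_{v,0}[p^∞] = (p^{ord_p #Ẽ(𝔽_p)})²`** — Lemma 3.4 at layer `0` as the TOWER doors' `h34₀` /
  `…EulerCharLayerZero.twoAdicEulerCharRankZero_of_layerZeroCount` consume it.

References: [GreenbergLNM1716] §3 Lemma 3.4 (p. 89), §2 pp. 70–75; [CoatesGreenberg1996] Cor. 3.2, Prop. 4.3.
-/

set_option autoImplicit false
-- the Theorems namespace of this sub repeats the summit name by design (D-0017 nested layout: Summit.<S>.<Sub>)
set_option linter.dupNamespace false

noncomputable section

open scoped Classical NNReal ValuativeRel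

universe u

namespace Summit.BirchSwinnertonDyer.BirchSwinnertonDyer.Theorems.GoodOrdTower

open NumberField IsDedekindDomain Field Literature.NumberTheory.EllipticCurves
  Literature.NumberTheory.GaloisRepresentations IsDedekindDomain.HeightOneSpectrum
  Literature.NumberTheory.EllipticCurves.FormalGroupChart Literature.NumberTheory.EllipticCurves.ResKernel
  Literature.NumberTheory.EllipticCurves.Rank1Residual WeierstrassCurve Rat.HeightOneSpectrum

variable {p : ℕ} [hp : Fact p.Prime] {κ : ZpExtension ℚ p}

set_option maxHeartbeats 3200000 in
/-- **Lemma 3.4 at layer `0` from the formal-group coinvariant count.** For `W/ℚ` globally minimal and elliptic with good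
ORDINARY reduction at `p`, the cyclotomic `ℤ_p`-extension `κ`, `v ∋ p`, the spectral valuation `w` and the reduction `red₀`
of the good model `W_ℤ ⊗ 𝒪_w` (`hred₀`), an inertial `g ∈ I_{ℚ_v}` generating `Γ_{ℚ_v} = H_0` topologically together with
`H_∞` (`hgI`, `hgen`), `M₁ = E(K̄_v)^{H_∞} ∩ ker red₀` (`hM₁`) with `D₁ = g − 1` (`hD₁`): if `(M₁/D₁M₁)[p^∞]` is finite of
order `p^{ord_p #Ẽ(𝔽_p)}`, then **`#𝒦_{v,0}[p^∞] = (p^{ord_p #Ẽ(𝔽_p)})²`** (`reductionPointCount W p = #Ẽ(𝔽_p)`).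
Assembly: (a) `natCard_localTowerKerPrimary_eq_coinv_atP`, (b) `natCard_primary_coinv_eq_mul` with the divisibility input
`coinvInput_ker_atP` for the local `ℤ_p`-extension generated by `g` (`exists_zpExtension_kerSubgroup_eq_isTopGenerator`) and
Hensel lifts (`exists_fixed_localRed_eq`), (d) `finite_range_localRed_fixedPoints_and_natCard_eq`.
[cite: GreenbergLNM1716, §3 Lemma 3.4 (p. 89)] [cite: CoatesGreenberg1996, Cor. 3.2 and Prop. 4.3] -/
theorem natCard_localTowerKerPrimary_zero_eq_sq_of_formalCount (hκ : κ.IsCyclotomic) (v : HeightOneSpectrum (𝓞 ℚ))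
    (hpv : ((p : ℕ) : 𝓞 ℚ) ∈ v.asIdeal) (W : WeierstrassCurve ℚ) [W.IsGloballyMinimal] [W.IsElliptic] (hgo : GoodOrd W p)
    {w : Valuation (AlgebraicClosure (v.adicCompletion ℚ)) ℝ≥0}
    (hw : ∀ x, (w x : ℝ) = spectralNorm (v.adicCompletion ℚ) (AlgebraicClosure (v.adicCompletion ℚ)) x)
    (red₀ : localPoints W (v.adicCompletion ℚ) →+
      (((integralModelInt W).map (algebraMap ℤ ↥w.valuationSubring)).map
        (IsLocalRing.residue ↥w.valuationSubring)).toAffine.Point)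
    (hred₀ : ∀ P : localPoints W (v.adicCompletion ℚ), red₀ P =
      ((integralModelInt W).map (algebraMap ℤ ↥w.valuationSubring)).reducePoint
        (Affine.Point.congrEquiv (localIntModel_baseChange W w.valuationSubring).symm P))
    {g : absoluteGaloisGroup (v.adicCompletion ℚ)} (hgI : g ∈ absInertia (v.adicCompletion ℚ))
    (hgen : ∀ U : Subgroup (absoluteGaloisGroup (v.adicCompletion ℚ)),
      IsOpen (U : Set (absoluteGaloisGroup (v.adicCompletion ℚ))) →
        localSubgroup κ.kerSubgroup (v.adicCompletion ℚ) ≤ U → g ∈ U →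
          localSubgroup (κ.layerSubgroup 0) (v.adicCompletion ℚ) ≤ U)
    (M₁ : AddSubgroup (localPoints W (v.adicCompletion ℚ)))
    (hM₁ : ∀ a, a ∈ M₁ ↔ a ∈ red₀.ker ∧ ∀ h ∈ localSubgroup κ.kerSubgroup (v.adicCompletion ℚ), h • a = a)
    (D₁ : M₁ →+ M₁) (hD₁ : ∀ a : M₁, ((D₁ a : M₁) : localPoints W (v.adicCompletion ℚ)) = g • (a : _) - a)
    [Finite (AddCommGroup.primaryComponent (M₁ ⧸ D₁.range) p)]
    (hF : Nat.card (AddCommGroup.primaryComponent (M₁ ⧸ D₁.range) p) = p ^ padicValNat p (W.reductionPointCount p)) :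
    Nat.card (W.localTowerKerPrimary κ (v.adicCompletion ℚ) 0) = (p ^ padicValNat p (W.reductionPointCount p)) ^ 2 := by
  -- notation
  let K := v.adicCompletion ℚ
  let Pt : Type := localPoints W K
  let Hi : Subgroup (absoluteGaloisGroup K) := localSubgroup κ.kerSubgroup K
  let M : AddSubgroup Pt := FixedPoints.addSubgroup Hi Pt
  -- the local data at `v ∣ p` (as in `…GoodOrdTowerControlLayerBoundP`)
  have hord : W.HasGoodReductionAtPrime p ∧ ¬ ((p : ℕ) : ℤ) ∣ W.frobeniusTrace p := hgo
  have hΔ : ¬ ((p : ℕ) : ℤ) ∣ minimalDiscriminantInt W :=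
    W.not_dvd_minimalDiscriminantInt_of_hasGoodReductionAtPrime' p hord.1
  have hvO : w.Integers w.valuationSubring := Valuation.valuationSubring.integers w
  have hΔu := W.isUnit_Δ_localIntModel hpv hw hΔ
  haveI hV : (W.baseChange (AlgebraicClosure K)).IsIntegral w.integer :=
    ⟨⟨(integralModelInt W).map (algebraMap ℤ ↥w.integer), W.baseChange_eq_localIntModel_integer_baseChange⟩⟩
  -- the Frobenius inside `H_∞`
  obtain ⟨𝔐, h𝔐⟩ := v.localPrimesAbove_nonempty
  have hϖ : Irreducible ((p : ℕ) : v.adicCompletionIntegers ℚ) := irreducible_natCast_adicCompletionIntegers_rat hpv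
  obtain ⟨τ, hτ, hτfix⟩ := exists_isArithFrobAt_forall_smul_eq hw h𝔐 hpv hϖ
  have hτHi : τ ∈ Hi :=
    (mem_localSubgroup_iff _ _ τ).mpr (resGal_mem_kerSubgroup_of_forall_smul_rootOfUnity_eq hκ hτfix)
  -- `g` acts trivially on reductions; Hensel lifts into `M^g`
  have hgred : ∀ Q : Pt, red₀ (g • Q) = red₀ Q := fun Q ↦
    localRed_smul_eq_of_mem_absInertia W hw red₀ hred₀ hpv h𝔐 hgI Q
  have hlift : ∀ x : M, ∃ x₀ : M, subOne Hi Pt g x₀ = 0 ∧ red₀ (x₀ : Pt) = red₀ (x : Pt) := fun x ↦ by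
    have hτx : τ • (x : Pt) = x := (FixedPoints.mem_addSubgroup _ _ _).mp x.2 ⟨τ, hτHi⟩
    obtain ⟨P₀, hP₀fix, hP₀⟩ := exists_fixed_localRed_eq W hw hΔu red₀ hred₀ hpv hΔ h𝔐 hτ (x : Pt) (by rw [hτx])
    refine ⟨⟨P₀, (FixedPoints.mem_addSubgroup _ _ _).mpr fun σ ↦ hP₀fix σ⟩, Subtype.ext ?_, hP₀⟩
    rw [coe_subOne_apply, hP₀fix, sub_self]; rfl
  -- (d) `#red₀(M) = #Ẽ(𝔽_p)`
  obtain ⟨hfinR, hR⟩ := finite_range_localRed_fixedPoints_and_natCard_eq (κ := κ) W hw hΔu red₀ hred₀ hpv hΔ h𝔐 hτ hτHi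
  haveI := hfinR
  -- (b) the divisibility input for the local `ℤ_p`-extension generated by `g`, and the dévissage
  obtain ⟨δ, hδ⟩ := Greenberg1999.exists_apply_resGal_ne_one_of_isCyclotomic hκ v
  have hE : ∃ δ : absoluteGaloisGroup K, resGal (K := ℚ) K δ ∉ κ.kerSubgroup :=
    ⟨δ, fun h ↦ hδ (ZpExtension.mem_kerSubgroup.mp h)⟩
  obtain ⟨κE, hker, hγ⟩ := exists_zpExtension_kerSubgroup_eq_isTopGenerator κ K hE hgen
  have hdiv := coinvInput_ker_atP W hgo κ hκ v hpv hw red₀ hred₀ ⟨κE, hker, hγ⟩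
  obtain ⟨hfinQ, hQ⟩ := natCard_primary_coinv_eq_mul W κ K red₀ hgred hlift M₁ hM₁ D₁ hD₁ hdiv
  haveI := hfinQ
  -- (a) `#𝒦_{v,0}[p^∞] = #(M/(g−1)M)[p^∞]`
  have hg0 : g ∈ localSubgroup (κ.layerSubgroup 0) K := by
    rw [mem_localSubgroup_iff, ZpExtension.layerSubgroup_zero]; exact Subgroup.mem_top _
  have hA := natCard_localTowerKerPrimary_eq_coinv_atP hκ v hpv W 0 hg0 hgen
  -- `#red₀(M)[p^∞] = p^{ord_p #Ẽ(𝔽_p)}`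
  have hRp : Nat.card (AddCommGroup.primaryComponent
      (red₀.comp M.subtype).range p) = p ^ padicValNat p (W.reductionPointCount p) := by
    rw [card_addPrimaryComponent_eq_pow, Nat.factorization_def _ hp.out, hR]
  rw [hA, hQ, hF, hRp, sq]

end Summit.BirchSwinnertonDyer.BirchSwinnertonDyer.Theorems.GoodOrdTower

end
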